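import Literature.Barriers.ABC.BakerMethodBoundsEpsShape
import Literature.NumberTheory.DiophantineGeometry.AbcWave0QualityFormProofs
import HarnessLib

/-!
# Effective height bounds for `S`-unit, `abc` and Mordell equations via modularity
# (von Känel 2014; von Känel–Matschke 2016/2023, §10.1–§10.4)

Topic `Literature/NumberTheory/DiophantineGeometry` (family `abc`, LADDER-ABC A1: the *modular method* —
Shimura–Taniyama + Faltings heights + modular degree — as opposed to Baker's method of
`Literature.Barriers.ABC.BakerMethodBounds`). This file TYPES, as cite-tagged named facts
(`def … : Prop`, D-0014; nothing here is proved except unfolding/API lemmas), the explicit height bounds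
printed in

* R. von Känel, B. Matschke, *Solving `S`-unit, Mordell, Thue, Thue–Mahler and generalized Ramanujan–Nagell
  equations via Shimura–Taniyama conjecture*, arXiv:1605.06079 (Feb. 2016 version, held TeX text) = Mem. AMS
  **286** (2023) no. 1419 [`VonkanelMatschke2023`]; ALL LOCATORS ARE THE arXiv NUMBERING (§10: Prop. 10.1 =
  `prop:m`, Prop. 10.2 = `prop:su`, Prop. 10.6 = `prop:abc`, display (10.x) `eq:asymptoticsu`);
* R. von Känel, *Integral points on moduli schemes of elliptic curves*, Trans. LMS **1** (2014) 85–115 =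
  arXiv:1310.7263 [`VonKanelModuli2014`]: Cor. 7.2, 7.3 (`S`-unit equation), Cor. 7.4, 7.5, 7.6 (Mordell).
Proof method in print: geometric Shimura–Taniyama + Faltings' method + modular degree / congruence number
bounds; no linear forms in logarithms (vKM §1.2.4).

## Setting (vKM §1, §10.2; vK §1.1.1), rendered

* `S` a finite set of rational primes: `S : Finset ℕ` with the hypothesis `∀ p ∈ S, p.Prime` in every
  statement; `N_S = ∏_{p ∈ S} p` (`= 1` for `S = ∅`) is `primesProd S`.
* `𝒪 = ℤ[1/N_S]`: `x : ℚ` lies in `𝒪` iff every prime dividing its (reduced) denominator lies in `S`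
  (`IsSInteger S x := x.den.primeFactors ⊆ S`); `x ∈ 𝒪^×` iff `x ≠ 0` and every prime dividing its
  numerator or denominator lies in `S` (`IsSUnit`).
* `h` = the usual absolute logarithmic Weil height on `ℚ`, `h(m/n) = log max(|m|,|n|)` for coprime
  `m, n`, `h(0) = 0` (vKM §1.3 "Notation"): Mathlib's `Height.logHeight₁ (x : ℚ)`
  (`Rat.logHeight₁_eq_log_max`).
* `a_S = 1728 N_S² ∏_{p ∉ S} p^{min(2, ord_p a)}` for `0 ≠ a ∈ 𝒪` (vKM (1.x) `def:asr2`, §10.3):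
  `mordellLevel S a`; von Känel 2014 uses `2⁸3⁵ N_S² ∏ … = 36 · a_S` (vK §1.1.1), written `36 * mordellLevel`.
* `log log log` is `Real.log ∘ Real.log ∘ Real.log`; in every statement its argument is `≥ 15 > e` on the
  printed domain (docstrings), where the printed principal value is real and agrees with it.

## What is here / what is NOT here

Here: Prop. 10.2, Prop. 10.6 (with the table (10.x) `eq:refinedcondbound`), (10.x) `eq:asymptoticsu`
(`eq_asymptoticsu`; the first rendering `abc_log_max_asymptotic` is RETIRED — vacuous, see its docstring),
Prop. 10.1, von Känel 2014 Cor. 7.2–7.6; API lemmas; and, PROVED from `sUnitEquation_height_le` (Prop. 10.2)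
by the printed translation `x = a/c, y = b/c`: `log c ≤ (5/2) R log R + 9R` for every `abc` triple
(`abcTriple_log_le_of_sUnit`), hence `Literature.Barriers.ABC.BakerShapeBound 1 1` (`κ = 41/2`) and
`Literature.Barriers.ABC.EpsShapeBound 1` (`bakerShapeBound_one_one_of_sUnit`, `epsShapeBound_one_of_sUnit`).
NOT here (sibling files): Prop. 10.7 / `Ω_opt` (`OptimizedHeightBoundsModularity.lean`), Prop. 10.8 and
(10.x) `eq:szpiro` (`EllipticCurves/HeightConductorBoundsModularity.lean`), Lemmas 10.3–10.5
(`EllipticCurves/SUnitMordellCurveConstructions.lean`), §§7–9 (`MordellThueRamanujanNagellHeightBounds.lean`);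
Part I (algorithms, Theorems A–F = computations). No `abc` claim: every bound here is EXPONENTIAL in the
radical, weaker for `rad → ∞` than Stewart–Yu (`Literature.NumberTheory.DiophantineGeometry.stewart_yu`) but
explicit and valid for ALL triples ("the actual best height bound for all sets `S` with `N_S ≤ 2^{90}`").
-/

noncomputable section

open Height

namespace Literature.NumberTheory.DiophantineGeometry

namespace VonKanelMatschke

/-! ### The setting: `N_S`, `𝒪 = ℤ[1/N_S]`, `𝒪^×`, `a_S` -/

/-- `N_S = ∏_{p ∈ S} p` for a finite set `S` of rational primes, with `N_S = 1` if `S = ∅`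
(vKM §1; vK §1.1.1). [cite: VonkanelMatschke2023, §1 (eq:sunit) and §10.2] -/
def primesProd (S : Finset ℕ) : ℕ := ∏ p ∈ S, p

/-- Membership in `𝒪 = ℤ[1/N_S]`: a rational number lies in `ℤ[1/N_S]` iff every prime dividing its
reduced denominator lies in `S`. [cite: VonkanelMatschke2023, §1 (𝒪 = ℤ[1/N_S])] -/
def IsSInteger (S : Finset ℕ) (x : ℚ) : Prop := x.den.primeFactors ⊆ S

/-- Membership in `𝒪^× = ℤ[1/N_S]^×` (the `S`-units of `ℚ`): `x ≠ 0` and every prime dividing the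
reduced numerator or denominator of `x` lies in `S`. [cite: VonkanelMatschke2023, §1 (eq:sunit)] -/
def IsSUnit (S : Finset ℕ) (x : ℚ) : Prop :=
  x ≠ 0 ∧ x.num.natAbs.primeFactors ⊆ S ∧ x.den.primeFactors ⊆ S

/-- `r₂(a) = ∏_{p ∉ S} p^{min(2, ord_p(a))}` for `0 ≠ a ∈ ℤ[1/N_S]` (vKM §10.3; product over the primes `p ∉ S`
dividing the numerator of `a`). [cite: VonkanelMatschke2023, §10.3 (r₂(a))] -/
def coprimePartTrunc (S : Finset ℕ) (a : ℚ) : ℕ :=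
  ∏ p ∈ a.num.natAbs.primeFactors \ S, p ^ min 2 (padicValNat p a.num.natAbs)

/-- `a_S = 1728 · N_S² · ∏_{p ∉ S} p^{min(2, ord_p(a))}` (vKM (1.x) `def:asr2` before Theorem G, and
§10.3: `a_S = 1728 N_S² r₂(a)`), the quantity "measuring the number `a ∈ 𝒪` and the finite set `S`" in
all Mordell-type bounds; for `S = ∅` it is written `a_*`. [cite: VonkanelMatschke2023, §1.2.1 (def:asr2) and §10.3] -/
def mordellLevel (S : Finset ℕ) (a : ℚ) : ℕ :=
  1728 * primesProd S ^ 2 * coprimePartTrunc S a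

/-- `N_∅ = 1`. [cite: VonkanelMatschke2023, §1] -/
theorem primesProd_empty : primesProd ∅ = 1 := by simp [primesProd]

/-- `N_S ≥ 1` when `S` consists of primes. [cite: VonkanelMatschke2023, §1] -/
theorem one_le_primesProd {S : Finset ℕ} (hS : ∀ p ∈ S, p.Prime) : 1 ≤ primesProd S := by
  rw [primesProd]
  exact Nat.one_le_iff_ne_zero.mpr (Finset.prod_ne_zero_iff.mpr fun p hp => (hS p hp).ne_zero)

/-- Rational integers lie in `ℤ[1/N_S]` for every `S`. [cite: VonkanelMatschke2023, §1] -/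
theorem isSInteger_intCast (S : Finset ℕ) (n : ℤ) : IsSInteger S (n : ℚ) := by
  simp [IsSInteger]

/-- `𝒪^× ⊆ 𝒪`. [cite: VonkanelMatschke2023, §1] -/
theorem IsSUnit.isSInteger {S : Finset ℕ} {x : ℚ} (h : IsSUnit S x) : IsSInteger S x := h.2.2

/-- An `S`-unit is nonzero. [cite: VonkanelMatschke2023, §1] -/
theorem IsSUnit.ne_zero {S : Finset ℕ} {x : ℚ} (h : IsSUnit S x) : x ≠ 0 := h.1

/-- Unfolding lemma for `a_S`. [cite: VonkanelMatschke2023, §10.3] -/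
theorem mordellLevel_def (S : Finset ℕ) (a : ℚ) :
    mordellLevel S a = 1728 * primesProd S ^ 2 *
      ∏ p ∈ a.num.natAbs.primeFactors \ S, p ^ min 2 (padicValNat p a.num.natAbs) := rfl

/-- `a_S ≥ 1728` when `S` consists of primes (so `log log log a_S` is real). [cite: VonkanelMatschke2023, §10.3] -/
theorem le_mordellLevel {S : Finset ℕ} (hS : ∀ p ∈ S, p.Prime) (a : ℚ) : 1728 ≤ mordellLevel S a := by
  have h1 : 1 ≤ primesProd S ^ 2 := Nat.one_le_pow _ _ (one_le_primesProd hS)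
  have h2 : 1 ≤ coprimePartTrunc S a := by
    rw [coprimePartTrunc]
    exact Nat.one_le_iff_ne_zero.mpr (Finset.prod_ne_zero_iff.mpr fun p hp =>
      pow_ne_zero _ (Nat.prime_of_mem_primeFactors (Finset.mem_sdiff.mp hp).1).ne_zero)
  calc 1728 = 1728 * 1 * 1 := by norm_num
    _ ≤ 1728 * primesProd S ^ 2 * coprimePartTrunc S a :=
        Nat.mul_le_mul (Nat.mul_le_mul_left _ h1) h2

/-! ### `S`-unit equations (vKM §10.1.2, Prop. 10.2 = `prop:su`) -/

/-- **von Känel–Matschke, Prop. 10.2** (`S`-unit equation `x + y = 1`, `(x, y) ∈ 𝒪^× × 𝒪^×`, `𝒪 = ℤ[1/N_S]`,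
(1.1) = (3.1) `eq:sunit`): *"Any solution `(x, y)` of the `S`-unit equation satisfies
`max(h(x), h(y)) ≤ (5/2) N_S log N_S + 9 N_S` and
`max(h(x), h(y)) ≤ (12/5) N_S log N_S + (9/10) N_S log log log(16 N_S) + 8.26 N_S + 28`."* (Both displays;
`16 N_S ≥ 16`, so the triple logarithm is real.) It updates Murty–Pasten's `4.8 N_S log N_S + 13 N_S + 25`
[`MurtyPasten2013`] and von Känel's 2014 bound, is "the actual best height bound for all sets `S` with
`N_S ≤ 2^{90}`", and is weaker than Stewart–Yu for `N_S → ∞`. Proof in print: §10.4, from Prop. 10.6 via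
`x = a/c`, `y = b/c`. [cite: VonkanelMatschke2023, Prop. 10.2 (arXiv §10.1.2, prop:su)] -/
def sUnitEquation_height_le : Prop :=
  ∀ (S : Finset ℕ), (∀ p ∈ S, p.Prime) → ∀ x y : ℚ, IsSUnit S x → IsSUnit S y → x + y = 1 →
    max (logHeight₁ x) (logHeight₁ y) ≤
        5 / 2 * (primesProd S : ℝ) * Real.log (primesProd S) + 9 * (primesProd S : ℝ) ∧
    max (logHeight₁ x) (logHeight₁ y) ≤
        12 / 5 * (primesProd S : ℝ) * Real.log (primesProd S) +
          9 / 10 * (primesProd S : ℝ) * Real.log (Real.log (Real.log (16 * (primesProd S : ℝ)))) +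
          8.26 * (primesProd S : ℝ) + 28

/-! ### The `abc`-form (vKM §10.4: (10.x) `eq:abc`, table `eq:refinedcondbound`, Prop. 10.6 = `prop:abc`,
asymptotic display `eq:asymptoticsu`) -/

/-- The exponent `𝔢 = 𝔢(ord₂(abc))` of the table (10.x) `eq:refinedcondbound`: `(𝔢, λ) = (4, 12)` if
`ord₂(abc) = 1`, `(2, 3)` if `ord₂(abc) ∈ {2, 3}`, `(−1, 1/2)` if `ord₂(abc) = 4`, `(0, 1)` if
`ord₂(abc) ≥ 5` (there `ord₂(N_E) = 𝔢 + 1` for the Frey–Hellegouarch curve of Lemma 10.5). The value at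
the argument `0`, which does not occur (`abc` is even for coprime `a + b = c`), is set to the
"`≥ 5`" row. [cite: VonkanelMatschke2023, §10.4 (eq:refinedcondbound)] -/
def refinedExp (v : ℕ) : ℤ :=
  if v = 1 then 4 else if v = 2 ∨ v = 3 then 2 else if v = 4 then -1 else 0

/-- The coefficient `λ = λ(ord₂(abc))` of the table (10.x) `eq:refinedcondbound` (see `refinedExp`).
[cite: VonkanelMatschke2023, §10.4 (eq:refinedcondbound)] -/
def refinedCoeff (v : ℕ) : ℝ :=
  if v = 1 then 12 else if v = 2 ∨ v = 3 then 3 else if v = 4 then 1 / 2 else 1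

/-- **von Känel–Matschke, Prop. 10.6** ("a (slightly) more precise version of Proposition 10.2"), for the
equation (10.x) `eq:abc`: `a + b = c`, `a, b, c ∈ ℤ ∖ {0}`, `gcd(a, b, c) = 1`, `rad(abc) ∣ N_S`. *"Suppose that
`(a, b, c)` is a solution of (eq:abc), and let `(𝔢, λ)` be the numbers in (eq:refinedcondbound) associated to
`(a, b, c)` [by `ord₂(abc)`]. Then
`log max(|a|,|b|,|c|) ≤ (λ/5) N_S log(2^𝔢 N_S) + (3λ/40) N_S log log log(2^𝔢 N_S) + (2λ/15) N_S + 28`."*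
(`2^𝔢 N_S` as a real power, `𝔢 = −1` allowed; on solutions `2^𝔢 N_S ≥ 15 > e`.) Proof in print: Lemma 10.5
(Frey–Hellegouarch curves) and the discriminant–conductor inequality (10.x) `eq:szpiro`.
[cite: VonkanelMatschke2023, Prop. 10.6 (arXiv §10.4, prop:abc)] -/
def abc_log_max_le_refined : Prop :=
  ∀ (S : Finset ℕ), (∀ p ∈ S, p.Prime) → ∀ a b c : ℤ, a ≠ 0 → b ≠ 0 → c ≠ 0 → a + b = c →
    Int.gcd (Int.gcd a b : ℤ) c = 1 →
    UniqueFactorizationMonoid.radical (a * b * c).natAbs ∣ primesProd S →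
      Real.log ((max |a| (max |b| |c|) : ℤ) : ℝ) ≤
        refinedCoeff (padicValNat 2 (a * b * c).natAbs) / 5 * (primesProd S : ℝ) *
            Real.log ((2 : ℝ) ^ refinedExp (padicValNat 2 (a * b * c).natAbs) * primesProd S) +
          3 * refinedCoeff (padicValNat 2 (a * b * c).natAbs) / 40 * (primesProd S : ℝ) *
            Real.log (Real.log (Real.log
              ((2 : ℝ) ^ refinedExp (padicValNat 2 (a * b * c).natAbs) * primesProd S))) +
          2 * refinedCoeff (padicValNat 2 (a * b * c).natAbs) / 15 * (primesProd S : ℝ) + 28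

/-- The radical `rad(z) ∈ ℕ` of an integer, computed in `ℕ` on `|z|` — a wrapper in the spirit of
`Literature.NumberTheory.DiophantineGeometry.rad`, so that a cast `(intRad z : ℝ)` cannot move the computation of
`UniqueFactorizationMonoid.radical` into the field `ℝ` (where `radical x = 1` for every `x`). Used for
`r = rad(abc)` in (10.x) `eq:asymptoticsu`. [cite: VonkanelMatschke2023, §1.3 Notation (rad(n))] -/
def intRad (z : ℤ) : ℕ := UniqueFactorizationMonoid.radical z.natAbs

/-- Unfolding lemma: `intRad z` is the radical of `|z|` computed in `ℕ`. [cite: VonkanelMatschke2023, §1.3 Notation (rad(n))] -/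
theorem intRad_def (z : ℤ) : intRad z = UniqueFactorizationMonoid.radical (M := ℕ) z.natAbs := rfl

/-- RETIRED — MIS-FORMALISED, VACUOUS (referee g18, 2026-08-26; kernel certificate `abc_log_max_asymptotic_vacuous`):
the casts `(UniqueFactorizationMonoid.radical … : ℝ)` below elaborate the radical IN THE FIELD `ℝ` (where it is
`1`), so the hypothesis `r₀ ≤ 1` is falsified by `r₀ = 2` and the statement says nothing. Kept byte-identical
(landed names are not edited in place); SUPERSEDED by `eq_asymptoticsu` (radical computed in `ℕ`, `intRad`). Do
not use. [cite: VonkanelMatschke2023, §10.4 display (eq:asymptoticsu) — retired rendering] -/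
def abc_log_max_asymptotic : Prop :=
  ∃ C r₀ : ℝ, ∀ a b c : ℤ, a ≠ 0 → b ≠ 0 → c ≠ 0 → a + b = c → Int.gcd (Int.gcd a b : ℤ) c = 1 →
    r₀ ≤ (UniqueFactorizationMonoid.radical (a * b * c).natAbs : ℝ) →
      Real.log ((max |a| (max |b| |c|) : ℤ) : ℝ) ≤
        9 / 5 * (UniqueFactorizationMonoid.radical (a * b * c).natAbs : ℝ) *
            Real.log (UniqueFactorizationMonoid.radical (a * b * c).natAbs) +
          C * ((UniqueFactorizationMonoid.radical (a * b * c).natAbs : ℝ) *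
            Real.log (UniqueFactorizationMonoid.radical (a * b * c).natAbs) /
            Real.log (Real.log (UniqueFactorizationMonoid.radical (a * b * c).natAbs)))

/-- Kernel certificate that `abc_log_max_asymptotic` is vacuous: provable with `C = 0`, `r₀ = 2` (the radical in
the field `ℝ` is `1 < 2`; referee g18). [cite: VonkanelMatschke2023, §10.4 display (eq:asymptoticsu) — retired rendering] -/
theorem abc_log_max_asymptotic_vacuous : abc_log_max_asymptotic := by
  refine ⟨0, 2, fun a b c _ _ _ _ _ hr => ?_⟩
  exfalso
  have h1 : (UniqueFactorizationMonoid.radical (((a * b * c).natAbs : ℕ) : ℝ)) = 1 := by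
    by_cases h0 : (((a * b * c).natAbs : ℕ) : ℝ) = 0
    · rw [h0, UniqueFactorizationMonoid.radical_zero]
    · exact UniqueFactorizationMonoid.radical_of_isUnit (isUnit_iff_ne_zero.mpr h0)
  rw [h1] at hr
  norm_num at hr

/-- **von Känel–Matschke, (10.x) `eq:asymptoticsu`** (display after the proof of Prop. 10.6; SUPERSEDES the
retired `abc_log_max_asymptotic`): *"any solution `(a, b, c)` of (eq:abc) with `rad(abc) = r` satisfies
`log max(|a|,|b|,|c|) ≤ (9/5) r log r + O(r log r / log log r)` for `r → ∞`"* (improving Murty–Pasten's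
`4 r log r + O(r log log r)`; weaker than Stewart–Yu's `O(r^{1/3}(log r)³)`). Rendered with an absolute
`O`-constant `C` and a threshold `r₀`, `r = intRad (abc)` (radical computed in `ℕ`, then cast to `ℝ`).
[cite: VonkanelMatschke2023, §10.4 display (eq:asymptoticsu)] -/
def eq_asymptoticsu : Prop :=
  ∃ C r₀ : ℝ, ∀ a b c : ℤ, a ≠ 0 → b ≠ 0 → c ≠ 0 → a + b = c → Int.gcd (Int.gcd a b : ℤ) c = 1 →
    r₀ ≤ ((intRad (a * b * c) : ℕ) : ℝ) →
      Real.log ((max |a| (max |b| |c|) : ℤ) : ℝ) ≤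
        9 / 5 * ((intRad (a * b * c) : ℕ) : ℝ) * Real.log ((intRad (a * b * c) : ℕ) : ℝ) +
          C * (((intRad (a * b * c) : ℕ) : ℝ) * Real.log ((intRad (a * b * c) : ℕ) : ℝ) /
            Real.log (Real.log ((intRad (a * b * c) : ℕ) : ℝ)))

/-! ### Consequences for `abc` triples in the tree's currency (PROVED from `sUnitEquation_height_le`):
`S` = primes of `abc`, `N_S = rad(abc)`, `(x, y) = (a/c, b/c)`, `max(h(x), h(y)) = log c` (vKM §10.4). -/

/-- For an `abc` triple and `S = ` the set of primes dividing `abc`: `N_S = rad(abc)`.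
[cite: VonkanelMatschke2023, §3.1 (N_S = rad(abc) for S = {p ∣ abc})] -/
theorem primesProd_primeFactors_eq_rad (a b c : ℕ) : primesProd (a * b * c).primeFactors = rad a b c := by
  rw [primesProd, rad_def, Nat.radical_eq_prod_primeFactors]

/-- For an `abc` triple, `a/c` is an `S`-unit for `S` = the primes of `abc`, with numerator `a`, denominator `c`.
[cite: VonkanelMatschke2023, §10.4 (proof of Prop. 10.2: x = a/c)] -/
theorem isSUnit_div_of_isABCTriple {a b c : ℕ} (ht : IsABCTriple a b c) :
    IsSUnit (a * b * c).primeFactors ((a : ℚ) / c) ∧ (((a : ℚ) / c).num = a ∧ ((a : ℚ) / c).den = c) := by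
  obtain ⟨ha, hb, habc, hcop⟩ := ht
  have hc : 0 < c := by omega
  have hac : Nat.Coprime a c := by rw [← habc]; exact Nat.coprime_self_add_right.mpr hcop
  have hc' : (0 : ℤ) < (c : ℤ) := by exact_mod_cast hc
  have hnum : (((a : ℤ) : ℚ) / ((c : ℤ) : ℚ)).num = a :=
    Rat.num_div_eq_of_coprime hc' (by simpa using hac)
  have hden : ((((a : ℤ) : ℚ) / ((c : ℤ) : ℚ)).den : ℤ) = c :=
    Rat.den_div_eq_of_coprime hc' (by simpa using hac)
  push_cast at hnum hden
  have hden' : (((a : ℚ) / c).den) = c := by exact_mod_cast hden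
  have habc0 : a * b * c ≠ 0 := by positivity
  refine ⟨⟨?_, ?_, ?_⟩, hnum, hden'⟩
  · exact div_ne_zero (by exact_mod_cast ha.ne') (by exact_mod_cast hc.ne')
  · rw [hnum, Int.natAbs_natCast]
    exact Nat.primeFactors_mono ⟨b * c, by ring⟩ habc0
  · rw [hden']
    exact Nat.primeFactors_mono ⟨a * b, by ring⟩ habc0

/-- **The `abc`-form of Prop. 10.2 for `abc` triples** (PROVED from the named fact): every `abc` triple satisfies
`log c ≤ (5/2) R log R + 9 R`, `R = rad(abc)` (the translation `x = a/c`, `y = b/c` of the printed proof).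
[cite: VonkanelMatschke2023, Prop. 10.2 with §10.4 (proof of Prop. 10.2)] -/
theorem abcTriple_log_le_of_sUnit (h : sUnitEquation_height_le) {a b c : ℕ} (ht : IsABCTriple a b c) :
    Real.log c ≤ 5 / 2 * (rad a b c : ℝ) * Real.log (rad a b c : ℕ) + 9 * (rad a b c : ℝ) := by
  have htb : IsABCTriple b a c := by
    obtain ⟨ha, hb, habc, hcop⟩ := ht; exact ⟨hb, ha, by omega, hcop.symm⟩
  obtain ⟨hx, hxnum, hxden⟩ := isSUnit_div_of_isABCTriple ht
  obtain ⟨hy, -, -⟩ := isSUnit_div_of_isABCTriple htb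
  have hS : ∀ p ∈ (a * b * c).primeFactors, p.Prime := fun p hp => Nat.prime_of_mem_primeFactors hp
  have hyS : IsSUnit (a * b * c).primeFactors ((b : ℚ) / c) := by
    have : b * a * c = a * b * c := by ring
    rw [this] at hy; exact hy
  obtain ⟨ha, hb, habc, -⟩ := ht
  have hc : (c : ℚ) ≠ 0 := by exact_mod_cast (show c ≠ 0 by omega)
  have hsum : (a : ℚ) / c + (b : ℚ) / c = 1 := by
    rw [← add_div, ← Nat.cast_add, habc, div_self hc]
  have hmain := (h _ hS _ _ hx hyS hsum).1
  rw [primesProd_primeFactors_eq_rad] at hmain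
  have hhx : logHeight₁ ((a : ℚ) / c) = Real.log c := by
    rw [Rat.logHeight₁_eq_log_max, hxnum, hxden, Int.natAbs_natCast, max_eq_right (by omega)]
  calc Real.log c = logHeight₁ ((a : ℚ) / c) := hhx.symm
    _ ≤ max (logHeight₁ ((a : ℚ) / c)) (logHeight₁ ((b : ℚ) / c)) := le_max_left _ _
    _ ≤ _ := hmain

/-- **Prop. 10.2 ⟹ the Baker shape `(θ, m) = (1, 1)`, `κ = 41/2`** (PROVED): `log c ≤ (41/2) R log R` for every
`abc` triple (`9R ≤ 18 R log R` as `R ≥ 2`) — the exponential class `Literature.Barriers.ABC.BakerShapeBound 1 1`,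
reached by a technique outside the linear-forms class of that barrier. [cite: VonkanelMatschke2023, Prop. 10.2] -/
theorem bakerShapeBound_one_one_of_sUnit (h : sUnitEquation_height_le) :
    Literature.Barriers.ABC.BakerShapeBound 1 1 := by
  refine ⟨41 / 2, fun a b c ht => ?_⟩
  have h1 := abcTriple_log_le_of_sUnit h ht
  have hR2 : (2 : ℝ) ≤ (rad a b c : ℝ) := by exact_mod_cast ht.two_le_rad
  have hlog : (1 : ℝ) / 2 ≤ Real.log (rad a b c : ℕ) := by
    have := Real.log_two_gt_d9
    have h2 : Real.log 2 ≤ Real.log (rad a b c : ℕ) := Real.log_le_log (by norm_num) hR2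
    linarith
  have hR0 : (0 : ℝ) ≤ (rad a b c : ℝ) := by linarith
  rw [Real.rpow_one, pow_one]
  nlinarith [mul_le_mul_of_nonneg_left hlog hR0]

/-- **Prop. 10.2 ⟹ the `ε`-shape with exponent `1`** (PROVED): for every `ε > 0`, `log c ≤ (41/(2ε)) rad(abc)^{1+ε}`
for all `abc` triples, i.e. `Literature.Barriers.ABC.EpsShapeBound 1` (= `EpsShapeBoundOne`, the tree's rung `A1.M2⁻`,
there proved via `p`-adic linear forms). [cite: VonkanelMatschke2023, Prop. 10.2] -/
theorem epsShapeBound_one_of_sUnit (h : sUnitEquation_height_le) :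
    Literature.Barriers.ABC.EpsShapeBound 1 := by
  obtain ⟨κ, hκ⟩ := bakerShapeBound_one_one_of_sUnit h
  intro ε hε
  refine ⟨κ / ε, 0, fun a b c ht _ => ?_⟩
  have h1 := hκ a b c ht
  rw [Real.rpow_one, pow_one] at h1
  have hR1 : (1 : ℝ) ≤ (rad a b c : ℝ) := Literature.Barriers.ABC.one_le_rad_real a b c
  have hR0 : (0 : ℝ) < (rad a b c : ℝ) := by linarith
  have hlog : Real.log (rad a b c : ℕ) ≤ (rad a b c : ℝ) ^ ε / ε := Real.log_le_rpow_div hR0.le hε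
  have hκ0 : 0 ≤ κ := by
    -- at the triple itself: `0 < log c ≤ κ R log R` with `R log R > 0`
    have hc : (2 : ℝ) ≤ c := by exact_mod_cast ht.two_le
    have hlc : 0 < Real.log c := Real.log_pos (by linarith)
    have hRl : 0 < (rad a b c : ℝ) * Real.log (rad a b c : ℕ) :=
      mul_pos hR0 (Real.log_pos (by exact_mod_cast ht.two_le_rad))
    nlinarith
  calc Real.log c ≤ κ * (rad a b c : ℝ) * Real.log (rad a b c : ℕ) := h1
    _ ≤ κ * (rad a b c : ℝ) * ((rad a b c : ℝ) ^ ε / ε) :=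
        mul_le_mul_of_nonneg_left hlog (mul_nonneg hκ0 hR0.le)
    _ = κ / ε * ((rad a b c : ℝ) ^ (1 : ℝ) * (rad a b c : ℝ) ^ ε) := by rw [Real.rpow_one]; ring
    _ = κ / ε * (rad a b c : ℝ) ^ (1 + ε : ℝ) := by rw [← Real.rpow_add hR0]

/-! ### Mordell equations (vKM §10.1.1, Prop. 10.1 = `prop:m`) -/

/-- The simplified Mordell bound `Ω_sim(a, S) = (1/3) h(a) + (4/9) a_S log a_S + (1/6) a_S log log log a_S
+ (2/5) a_S` of Prop. 10.1 (so named in §8.2 and §9: "`Ω_opt ≤ Ω_sim`").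
[cite: VonkanelMatschke2023, Prop. 10.1 and §8.2/§9 (Ω_sim)] -/
def omegaSim (S : Finset ℕ) (a : ℚ) : ℝ :=
  1 / 3 * logHeight₁ a + 4 / 9 * (mordellLevel S a : ℝ) * Real.log (mordellLevel S a) +
    1 / 6 * (mordellLevel S a : ℝ) * Real.log (Real.log (Real.log (mordellLevel S a))) +
    2 / 5 * (mordellLevel S a : ℝ)

/-- **von Känel–Matschke, Prop. 10.1** (Mordell equation `y² = x³ + a`, `(x, y) ∈ 𝒪 × 𝒪`, `0 ≠ a ∈ 𝒪`,
(1.2) `eq:mordell`): *"If `x, y ∈ 𝒪` satisfy `y² = x³ + a`, then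
`max(h(x), (2/3) h(y)) ≤ (1/3) h(a) + (4/9) a_S log a_S + (1/6) a_S log log log a_S + (2/5) a_S`"* (`= Ω_sim`;
`a_S ≥ 1728`). It updates `h(a) + 4·36a_S log(36a_S)²` of [vK 2014] and gives (10.x) `eq:simplemordell`
`max(h(x), h(y)) ≤ (1/2) h(a) + a_S log a_S`. Proof in print: §10.3 (Lemma 10.3, Prop. 10.8 (ii)).
[cite: VonkanelMatschke2023, Prop. 10.1 (arXiv §10.1.1, prop:m)] -/
def mordell_height_le : Prop :=
  ∀ (S : Finset ℕ), (∀ p ∈ S, p.Prime) → ∀ a : ℚ, a ≠ 0 → IsSInteger S a →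
    ∀ x y : ℚ, IsSInteger S x → IsSInteger S y → y ^ 2 = x ^ 3 + a →
      max (logHeight₁ x) (2 / 3 * logHeight₁ y) ≤ omegaSim S a

/-! ### von Känel 2014, Cor. 7.2–7.6 (the first modularity bounds; superseded numerically by the above) -/

/-- **von Känel 2014, Cor. 7.2** (`S`-unit equation (1.1) = `eq:unit`, `n_S = 2⁷ N_S`): *"Any solution `(x, y)`
of the `S`-unit equation satisfies `h(x), h(y) ≤ (3/2) n_S (log n_S)² + 65`."* ("an effective version of Frey's
remark".) Proof in print: `h(x) ≤ 6h(E) + 11`, `N_E ≤ n_S`, Prop. 6.1. [cite: VonKanelModuli2014, Cor. 7.2] -/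
def vonKanel2014_sUnit_height_le : Prop :=
  ∀ (S : Finset ℕ), (∀ p ∈ S, p.Prime) → ∀ x y : ℚ, IsSUnit S x → IsSUnit S y → x + y = 1 →
    max (logHeight₁ x) (logHeight₁ y) ≤
      3 / 2 * (2 ^ 7 * primesProd S : ℝ) * Real.log (2 ^ 7 * primesProd S : ℝ) ^ 2 + 65

/-- **von Känel 2014, Cor. 7.3**: *"The `S`-unit equation has at most `4 n_S ∏_{p ∈ S}(1 + 1/p)`
solutions"* (`n_S = 2⁷ N_S`). Rendered: the solution set is finite and its cardinality (`Set.ncard`) is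
at most that real number. [cite: VonKanelModuli2014, Cor. 7.3] -/
def vonKanel2014_sUnit_card_le : Prop :=
  ∀ (S : Finset ℕ), (∀ p ∈ S, p.Prime) →
    {xy : ℚ × ℚ | IsSUnit S xy.1 ∧ IsSUnit S xy.2 ∧ xy.1 + xy.2 = 1}.Finite ∧
      ({xy : ℚ × ℚ | IsSUnit S xy.1 ∧ IsSUnit S xy.2 ∧ xy.1 + xy.2 = 1}.ncard : ℝ) ≤
        4 * (2 ^ 7 * primesProd S : ℝ) * ∏ p ∈ S, (1 + 1 / (p : ℝ))

/-- **von Känel 2014, Cor. 7.4** (Mordell equation (1.2), `0 ≠ a ∈ 𝒪`; 2014 normalisation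
`a_S = 2⁸3⁵ N_S² ∏_{p ∉ S} p^{min(2, ord_p a)} = 36 · mordellLevel S a`): *"If `(x, y)` satisfies Mordell's equation,
then `h(x), h(y) ≤ h(a) + 4 a_S (log a_S)²`"* ("an entirely new proof of Baker's classical result").
[cite: VonKanelModuli2014, Cor. 7.4] -/
def vonKanel2014_mordell_height_le : Prop :=
  ∀ (S : Finset ℕ), (∀ p ∈ S, p.Prime) → ∀ a : ℚ, a ≠ 0 → IsSInteger S a →
    ∀ x y : ℚ, IsSInteger S x → IsSInteger S y → y ^ 2 = x ^ 3 + a →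
      max (logHeight₁ x) (logHeight₁ y) ≤
        logHeight₁ a + 4 * (36 * mordellLevel S a : ℝ) * Real.log (36 * mordellLevel S a : ℝ) ^ 2

/-- **von Känel 2014, Cor. 7.5** ("generalizes and refines Stark's theorem"): *"If `ε > 0` is a real
number, then there exists an effective constant `c`, depending only on `ε`, such that any solution
`(x, y)` of Mordell's equation satisfies `h(x), h(y) ≤ h(a) + c · a_S^{1+ε}`"* (2014 normalisation of
`a_S` as in `vonKanel2014_mordell_height_le`). Effectivity of `c` is not expressible and is dropped
(a weakening). [cite: VonKanelModuli2014, Cor. 7.5] -/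
def vonKanel2014_mordell_height_le_rpow : Prop :=
  ∀ ε : ℝ, 0 < ε → ∃ c : ℝ, ∀ (S : Finset ℕ), (∀ p ∈ S, p.Prime) → ∀ a : ℚ, a ≠ 0 → IsSInteger S a →
    ∀ x y : ℚ, IsSInteger S x → IsSInteger S y → y ^ 2 = x ^ 3 + a →
      max (logHeight₁ x) (logHeight₁ y) ≤ logHeight₁ a + c * (36 * mordellLevel S a : ℝ) ^ (1 + ε)

/-- **von Känel 2014, Cor. 7.6**: *"The number of solutions of [Mordell's equation (1.2)] is at most
`(2/3) a_S ∏_{p ∣ a_S} (1 + 1/p)` with the product taken over all rational primes `p` which divide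
`a_S`"* (2014 normalisation `a_S = 36 · mordellLevel S a`). Rendered with `Set.ncard` and finiteness.
[cite: VonKanelModuli2014, Cor. 7.6] -/
def vonKanel2014_mordell_card_le : Prop :=
  ∀ (S : Finset ℕ), (∀ p ∈ S, p.Prime) → ∀ a : ℚ, a ≠ 0 → IsSInteger S a →
    {xy : ℚ × ℚ | IsSInteger S xy.1 ∧ IsSInteger S xy.2 ∧ xy.2 ^ 2 = xy.1 ^ 3 + a}.Finite ∧
      ({xy : ℚ × ℚ | IsSInteger S xy.1 ∧ IsSInteger S xy.2 ∧ xy.2 ^ 2 = xy.1 ^ 3 + a}.ncard : ℝ) ≤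
        2 / 3 * (36 * mordellLevel S a : ℝ) *
          ∏ p ∈ (36 * mordellLevel S a).primeFactors, (1 + 1 / (p : ℝ))

end VonKanelMatschke

end Literature.NumberTheory.DiophantineGeometry

end
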